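import Mathlib.Analysis.SpecialFunctions.Complex.Arg
import Mathlib.Analysis.SpecialFunctions.Trigonometric.Inverse
import Mathlib.Analysis.SpecialFunctions.Log.Basic
import Mathlib.Analysis.InnerProductSpace.PiL2
import Mathlib.Algebra.Order.Round
import Literature.Probability.LatticeModels.PairIsing
import HarnessLib

/-!
# The pair-coupling Ising model on a finite log-polar grid (names for route `LogPolarProxy`)

Topic `Probability/LatticeModels`; definitions + unfolding lemmas, no named facts. Requested by
the definition item `defn-logPolarIsingCorr`: the route
`CriticalPhenomena/Ising3DConformalLimit/LogPolarProxy` (items `ProxyUniversality`,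
`ProxyInversionTransfer`, `ProxyReflectionSymmetry`) INLINES the following objects as long
`if`-chains and anonymous-constructor tuples; they are named here, with bodies SYNTACTICALLY the
inlined terms up to the spelling of the Gibbs average — the light module's `PairIsing.gibbsAvg`
(`PairIsing.lean`, imports `Correlations` only) in place of the definitionally equal
`PairIsing.avg` of `GaussianPairingBoundCouplings.lean` (`PairIsing.avg_eq_gibbsAvg : avg c f =
gibbsAvg c f := rfl` there) — so that the items can be restated over the names by
`route edit --restate` without change of meaning (`logPolarIsingCorr_eq_inline` is `rfl`), and so
that this file, hence any route importing it, stays outside the random-current / GKS import cone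
(definition item `defn-PairIsing.avg`).

* `LogPolarIdx N = Fin (2(N+1)²+1) × Fin (N+1) × Fin (2N+2)` — the index set of the finite
  log-polar grid of mesh `δ = π/(N+1)`: radial shell `i ↔ s = (i - (N+1)²) δ` (log-radius),
  polar row `j ↔ θ = (j + ½) δ`, azimuth `k ↔ φ = k δ` (periodic);
* `logPolarCoupling Jr Jt Jp N : LogPolarIdx N → LogPolarIdx N → ℝ` — nearest-neighbour
  (ordered-)pair couplings: `Jr N j` on radial bonds, `Jt N (min j j')` on polar bonds,
  `Jp N j` on azimuthal bonds (periodic in `k`), `0` otherwise;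
* `logPolarVertex N q : LogPolarIdx N` — the grid cell of a point `q ∈ ℝ³` (off the `x₃`-axis):
  `(round (log |q| / δ) + (N+1)²` clamped to the shells, `⌊arccos (q₃/|q|) / δ⌋` clamped,
  `⌊arg (q₁ + i q₂) / δ⌋ mod 2N+2)`;
* `logPolarIsingCorr Jr Jt Jp N n p = PairIsing.gibbsAvg (logPolarCoupling Jr Jt Jp N)
  (spinMonomial (logPolarVertex N ∘ p))` — the free-b.c. pair-coupling Ising correlator
  `⟨∏ σ_{v_N(p_i)}⟩` of the proxy (the free-boundary Gibbs average `PairIsing.gibbsAvg` of the light module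
  `PairIsing.lean`, definitionally equal to `PairIsing.avg` of `GaussianPairingBoundCouplings.lean`
  (`PairIsing.avg_eq_gibbsAvg`), Newman 1975 (1.1));
* API: `logPolarIsingCorr_eq_inline` (`rfl` bridge to the route's verbatim inlined term),
  `logPolarCoupling_rev_rev` (the couplings are invariant under the reflection `i ↦ rev i` of
  the radial shells, i.e. the inversion `s ↦ -s` — the symmetry behind `ProxyReflectionSymmetry`),
  unfolding lemmas.

Design notes. These are the route's own finite-volume objects (a specific finite weighted graph
and the standard Gibbs average on it); nothing here is a claim about the Ising model — the tags
are `[folklore]` (generic constructions), and the semantics (why this grid, which couplings) is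
the route's (see its module docstring). Not done here (listed in the item as "also useful"):
invariance of the couplings under the azimuthal rotation `k ↦ k + 1`, and
`logPolarVertex N (q / |q|²) = (rev, id, id) (logPolarVertex N q)` off half-integer shells.
-/

noncomputable section

namespace Literature.Probability.LatticeModels

/-- The index set of the finite log-polar grid at resolution `N` (mesh `δ = π/(N+1)`):
radial shells `Fin (2(N+1)²+1)`, polar rows `Fin (N+1)`, azimuths `Fin (2N+2)`. [folklore] -/
abbrev LogPolarIdx (N : ℕ) : Type := Fin (2 * (N + 1) ^ 2 + 1) × Fin (N + 1) × Fin (2 * N + 2)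

/-- **The nearest-neighbour couplings of the log-polar grid**: `Jr N j` on radial bonds (same row
`j` and azimuth, consecutive shells), `Jt N (min j j')` on polar bonds (same shell and azimuth,
consecutive rows), `Jp N j` on azimuthal bonds (same shell and row, cyclically consecutive
azimuths), `0` on all other ordered pairs — verbatim the `if`-chain inlined in route
`LogPolarProxy`. [folklore] -/
def logPolarCoupling (Jr Jt Jp : ℕ → ℕ → ℝ) (N : ℕ) (a b : LogPolarIdx N) : ℝ :=
  if a.2.1 = b.2.1 ∧ a.2.2 = b.2.2 ∧ (a.1.val + 1 = b.1.val ∨ b.1.val + 1 = a.1.val) then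
    Jr N a.2.1.val
  else if a.1 = b.1 ∧ a.2.2 = b.2.2 ∧ (a.2.1.val + 1 = b.2.1.val ∨ b.2.1.val + 1 = a.2.1.val) then
    Jt N (min a.2.1.val b.2.1.val)
  else if a.1 = b.1 ∧ a.2.1 = b.2.1 ∧ (a.2.2.val + 1 = b.2.2.val ∨ b.2.2.val + 1 = a.2.2.val ∨
      (a.2.2.val = 0 ∧ b.2.2.val = 2 * N + 1) ∨ (b.2.2.val = 0 ∧ a.2.2.val = 2 * N + 1)) then
    Jp N a.2.1.val
  else 0

/-- **The grid cell of a point** `q ∈ ℝ³` (meaningful off the `x₃`-axis): shell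
`round (log |q| / δ) + (N+1)²` clamped to `[0, 2(N+1)²]`, row `⌊arccos (q₃ / |q|) / δ⌋` clamped
to `[0, N]`, azimuth `⌊arg (q₁ + i q₂) / δ⌋ mod (2N+2)`, `δ = π/(N+1)` — verbatim the tuple
inlined in route `LogPolarProxy`. [folklore] -/
def logPolarVertex (N : ℕ) (q : EuclideanSpace ℝ (Fin 3)) : LogPolarIdx N :=
  ((⟨min (2 * (N + 1) ^ 2) (Int.toNat (round (Real.log ‖q‖ / (Real.pi / (N + 1))) + (N + 1) ^ 2)),
      Nat.lt_add_one_of_le (min_le_left _ _)⟩,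
    ⟨min N (Int.toNat ⌊Real.arccos (q 2 / ‖q‖) / (Real.pi / (N + 1))⌋),
      Nat.lt_add_one_of_le (min_le_left _ _)⟩,
    ⟨Int.toNat (⌊Complex.arg ⟨q 0, q 1⟩ / (Real.pi / (N + 1))⌋ + (2 * N + 2)) % (2 * N + 2),
      Nat.mod_lt _ (Nat.succ_pos _)⟩) : LogPolarIdx N)

/-- **The log-polar proxy correlator**: the free-boundary pair-coupling Ising average
(`PairIsing.gibbsAvg`, Newman 1975 (1.1)) of the spin monomial at the grid cells of the points
`p_1, …, p_n`, with the couplings `logPolarCoupling Jr Jt Jp N`. [folklore] -/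
def logPolarIsingCorr (Jr Jt Jp : ℕ → ℕ → ℝ) (N n : ℕ)
    (p : Fin n → EuclideanSpace ℝ (Fin 3)) : ℝ :=
  PairIsing.gibbsAvg (logPolarCoupling Jr Jt Jp N) (spinMonomial (logPolarVertex N ∘ p))

/-! ### Unfolding lemmas -/

/-- Unfolding `logPolarIsingCorr` over the names (definitional). [folklore] -/
theorem logPolarIsingCorr_def (Jr Jt Jp : ℕ → ℕ → ℝ) (N n : ℕ)
    (p : Fin n → EuclideanSpace ℝ (Fin 3)) :
    logPolarIsingCorr Jr Jt Jp N n p =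
      PairIsing.gibbsAvg (logPolarCoupling Jr Jt Jp N) (spinMonomial (logPolarVertex N ∘ p)) := rfl

/-- **Bridge to the route's inlined term** (`rfl`): `logPolarIsingCorr` is SYNTACTICALLY the
expression inlined in items `ProxyUniversality` / `ProxyInversionTransfer` of route
`LogPolarProxy` (rev 1), with the Gibbs average spelled `PairIsing.gibbsAvg` (light module) instead
of the definitionally equal `PairIsing.avg`, so those items can be restated over the name without
change of meaning. [folklore] -/
theorem logPolarIsingCorr_eq_inline (Jr Jt Jp : ℕ → ℕ → ℝ) (N n : ℕ)
    (p : Fin n → EuclideanSpace ℝ (Fin 3)) :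
    logPolarIsingCorr Jr Jt Jp N n p =
      PairIsing.gibbsAvg (fun a b : Fin (2 * (N + 1) ^ 2 + 1) × Fin (N + 1) × Fin (2 * N + 2) =>
        if a.2.1 = b.2.1 ∧ a.2.2 = b.2.2 ∧ (a.1.val + 1 = b.1.val ∨ b.1.val + 1 = a.1.val) then
          Jr N a.2.1.val
        else if a.1 = b.1 ∧ a.2.2 = b.2.2 ∧
            (a.2.1.val + 1 = b.2.1.val ∨ b.2.1.val + 1 = a.2.1.val) then
          Jt N (min a.2.1.val b.2.1.val)
        else if a.1 = b.1 ∧ a.2.1 = b.2.1 ∧ (a.2.2.val + 1 = b.2.2.val ∨ b.2.2.val + 1 = a.2.2.val ∨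
            (a.2.2.val = 0 ∧ b.2.2.val = 2 * N + 1) ∨ (b.2.2.val = 0 ∧ a.2.2.val = 2 * N + 1)) then
          Jp N a.2.1.val
        else 0)
      (spinMonomial fun i : Fin n =>
        ((⟨min (2 * (N + 1) ^ 2)
            (Int.toNat (round (Real.log ‖p i‖ / (Real.pi / (N + 1))) + (N + 1) ^ 2)),
            Nat.lt_add_one_of_le (min_le_left _ _)⟩,
          ⟨min N (Int.toNat ⌊Real.arccos (p i 2 / ‖p i‖) / (Real.pi / (N + 1))⌋),
            Nat.lt_add_one_of_le (min_le_left _ _)⟩,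
          ⟨Int.toNat (⌊Complex.arg ⟨p i 0, p i 1⟩ / (Real.pi / (N + 1))⌋ + (2 * N + 2)) % (2 * N + 2),
            Nat.mod_lt _ (Nat.succ_pos _)⟩) :
          Fin (2 * (N + 1) ^ 2 + 1) × Fin (N + 1) × Fin (2 * N + 2))) := rfl

/-- The route's `ProxyReflectionSymmetry` left-hand side over the names: the correlator of the
radially reflected cells (definitional). [folklore] -/
theorem avg_spinMonomial_rev_eq (Jr Jt Jp : ℕ → ℕ → ℝ) (N n : ℕ) (v : Fin n → LogPolarIdx N) :
    PairIsing.gibbsAvg (logPolarCoupling Jr Jt Jp N)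
        (spinMonomial fun i : Fin n => ((Fin.rev (v i).1, (v i).2) : LogPolarIdx N)) =
      PairIsing.gibbsAvg (logPolarCoupling Jr Jt Jp N)
        (spinMonomial ((fun a : LogPolarIdx N => ((Fin.rev a.1, a.2) : LogPolarIdx N)) ∘ v)) := rfl

/-! ### The radial reflection preserves the couplings -/

/-- The **radial reflection** `(i, j, k) ↦ (rev i, j, k)` of the grid (the inversion `s ↦ -s` of
the log-radius). [folklore] -/
def logPolarReflect (N : ℕ) (a : LogPolarIdx N) : LogPolarIdx N := (Fin.rev a.1, a.2)

/-- The radial reflection is an involution. [folklore] -/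
@[simp] theorem logPolarReflect_logPolarReflect (N : ℕ) (a : LogPolarIdx N) :
    logPolarReflect N (logPolarReflect N a) = a := by
  simp [logPolarReflect]

/-- **The couplings are invariant under the radial reflection** (the grid and its bonds are
symmetric under `s ↦ -s`; radial adjacency `i' = i ± 1` is preserved by `rev`, and the couplings
do not depend on the shell index) — the symmetry behind item `ProxyReflectionSymmetry`.
[folklore] -/
theorem logPolarCoupling_reflect (Jr Jt Jp : ℕ → ℕ → ℝ) (N : ℕ) (a b : LogPolarIdx N) :
    logPolarCoupling Jr Jt Jp N (logPolarReflect N a) (logPolarReflect N b) =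
      logPolarCoupling Jr Jt Jp N a b := by
  obtain ⟨ia, ja, ka⟩ := a
  obtain ⟨ib, jb, kb⟩ := b
  have hrev : ∀ x y : Fin (2 * (N + 1) ^ 2 + 1), (Fin.rev x = Fin.rev y ↔ x = y) := fun x y =>
    Fin.rev_injective.eq_iff
  have hadj : ((Fin.rev ia).val + 1 = (Fin.rev ib).val ∨ (Fin.rev ib).val + 1 = (Fin.rev ia).val) ↔
      (ia.val + 1 = ib.val ∨ ib.val + 1 = ia.val) := by
    simp only [Fin.val_rev]
    omega
  simp only [logPolarCoupling, logPolarReflect, hrev, hadj]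

end Literature.Probability.LatticeModels
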